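import Literature.Algebra.Lie.LefschetzModuleKleimanAlgebra
import Literature.AlgebraicGeometry.Motives.HodgeStructureHodgeStarLefschetzGroup
import HarnessLib

/-!
# `ℚ[L, ᶜΛ] = ℚ[L, Λ] = ℚ[L, *_L] = ℚ[L, ∗]` on the exterior algebra of a symplectic space, with the Künneth projectors
# (André 1996 Prop. 1.2, Kleiman 1968 1.4.4–1.4.5, Milne 1999 Thm. 5.9 "this algebra contains `ᶜΛ` and `∗`")

[topic AlgebraicGeometry/Motives]

Layer `Literature/AlgebraicGeometry/Motives`, lane `lit-hodgefound` (Track 2 foundations library; prover seat `lit-hodgefound-p34`,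
generation 30, row g30-#2).  The READING of row g30-#1 (`Algebra/Lie/LefschetzModuleKleimanAlgebra.lean`: on an abstract Lefschetz
module `*_L ∈ K[e, ᶜΛ]`, the four algebras of André's Prop. 1.2 coincide and contain the degree projectors) on the Lefschetz module
`(⋀ W, h, e_ω)` of a non-degenerate 2-vector `ω` of genus `g` (rows g29-#1 `HodgeStructureExteriorAlgebraLefschetzModule`, g29-#4
`HodgeStructureExteriorAlgebraLefschetzInvolution`: `lefschetzStar = *_L`, `hodgeStar = ∗`, `lefschetzDual = ᶜΛ`), and on the carrier
`⋀_ℚ V` of an odd-weight polarized `ℚ`-Hodge structure with its Lefschetz class `E_Q` (row g29-#6 `HodgeStructureHodgeStarLefschetzGroup`).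
PROVED theorems only (no definition, no named fact, no `sorry`, no instance, no notation; net debt `0`).

## Sources, VERBATIM

J. S. Milne, *Lefschetz classes on abelian varieties*, Duke Math. J. **96** (1999) [Milne1999LefschetzClasses] (held
`paper:doi-10-1215-s0012-7094-99-09620-5`), p. 664 (p0026 L47–L66): "For `x = Σ Lⁱ xᵢ ∈ Hˢ(X)`, define `Λx = Σ_{i ≥ s-d, 1} L^{i-1} xᵢ`,
`ᶜΛx = Σ_{i ≥ s-d, 1} i(d - s + i + 1) L^{i-1} xᵢ`, `∗x = Σ_{i ≥ s-d, 0} (-1)^{(s-2i)(s-2i+1)/2} L^{d-s+i} xᵢ`."; Thm. 5.9, proof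
(p. 665 = p0027 L5–L9): "It is known (e.g., Kleiman 1968, p367) that `Λ`, regarded as a map of cohomology groups, is inverse to `L`.
[…] Consequently, all elements of the `ℚ`-algebra `ℚ[L, Λ]` are Lefschetz. Since this algebra contains `ᶜΛ` and `∗` (Kleiman 1968,
1.4.4), this completes the proof."
Y. André, *Pour une théorie inconditionnelle des motifs*, Publ. Math. IHÉS **83** (1996) [Andre1996Motifs], §1.2 and Prop. 1.2
(p. 11 = p0008 L27–L29, L62–L66): "Notons `πʲ` le projecteur de Künneth sur `Hʲ(X)`, et posons `h = Σ (d - j) πʲ` […]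
Les sous-algèbres `ℚ[L, *_L]`, `ℚ[L, *_H]`, `ℚ[L, *_L L *_L]`, `ℚ[L, ᶜΛ]` de `End H*(X)` sont égales et contiennent les projecteurs
de Künneth."; proof (p. 12): "on renvoie à [Kl68] 1.4.4, 1.4.5."

## Rendering (dictionary of rows g29-#1/#4/#6)

On `⋀ W` (`W` of dimension `2g` over a field `K` of characteristic `0`, `ω` with `IsSymplectic ω g`, `g ≥ 1`): `L = e_ω =
LinearMap.mul K _ ω`, `h = shiftedDegree K (fun i ↦ ⋀[K]^i W) g` (`= k - g` on `⋀ᵏ W`), `ᶜΛ = lefschetzDual ω g` (the `𝔰𝔩₂`-partner,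
`dual_eq_lefschetzDual`), `*_L = lefschetzStar ω g`, `∗ = *_H = hodgeStar ω g`, Milne's `Λ` ("inverse to `L`") `= *_L e_ω *_L`, and
"le projecteur de Künneth `πʲ`" = Mathlib's `GradedAlgebra.proj (fun i ↦ ⋀[K]^i W) j`.  On the carrier of a polarized odd-weight
`ℚ`-Hodge structure `(H, Q)` with `dim V = 2g`: `ω = E_Q = Q.lefschetzClass` (symplectic of genus `g`,
`Polarization.isSymplectic_lefschetzClass`), `ℚ[B¹]` = the `ℚ`-subalgebra of `⋀_ℚ V` generated by the degree-two Hodge classes.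

## Contents (all proved; `hω : IsSymplectic ω g`, `hg : 0 < g`)

* §1 on `⋀ W`: `IsSymplectic.shiftedDegree_mem_adjoin_lefschetzDual` (`h ∈ K[e_ω, ᶜΛ]`), **`IsSymplectic.proj_mem_adjoin_lefschetzDual`**
  (the Künneth projectors `πʲ ∈ K[e_ω, ᶜΛ]`), **`IsSymplectic.lefschetzStar_mem_adjoin_lefschetzDual`** (`*_L ∈ K[e_ω, ᶜΛ]`, Kleiman
  1.4.5), **`IsSymplectic.hodgeStar_mem_adjoin_lefschetzDual`** (`∗ ∈ K[e_ω, ᶜΛ]`), `IsSymplectic.conj_lefschetzStar_mem_adjoin_lefschetzDual`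
  (Milne's `Λ ∈ K[e_ω, ᶜΛ]`), the equalities **`IsSymplectic.adjoin_lefschetzStar_eq_adjoin_lefschetzDual`** (`K[e_ω, *_L] = K[e_ω, ᶜΛ]`),
  `IsSymplectic.adjoin_hodgeStar_eq_adjoin_lefschetzDual` (`K[e_ω, ∗] = K[e_ω, ᶜΛ]`), `IsSymplectic.adjoin_conj_lefschetzStar_eq_adjoin_lefschetzDual`
  (Milne's `ℚ[L, Λ] = K[e_ω, ᶜΛ]`), and MILNE'S SENTENCE for his `ℚ[L, Λ]` literally: `IsSymplectic.lefschetzDual_mem_adjoin_conj_lefschetzStar`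
  (`ᶜΛ ∈ ℚ[L, Λ]`, Kleiman 1.4.4), `IsSymplectic.hodgeStar_mem_adjoin_conj_lefschetzStar` (`∗ ∈ ℚ[L, Λ]`), `IsSymplectic.proj_mem_adjoin_conj_lefschetzStar`
  (`πʲ ∈ ℚ[L, Λ]`); `Sp(ω)`-equivariance of the whole algebra `IsSymplectic.commute_map_of_mem_adjoin_lefschetzDual`.
* §2 on the polarized-Hodge-structure carrier: **`Polarization.apply_mem_adjoin_hodgeClasses_two_of_mem_adjoin_lefschetzDual`**
  (every `T ∈ ℚ[e_E, ᶜΛ_E]` maps `ℚ[B¹]` into itself — Thm. 5.9's "all elements of `ℚ[L, Λ]` are Lefschetz" for the algebra in all four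
  spellings), `Polarization.apply_mem_map_divisorClasses_of_mem_adjoin_lefschetzDual` (Prop. 5.7 form: such a `T` of degree
  `2p ↦ 2q` maps `Dᵖ` into `D^q`).

The concrete-carrier statements of `HodgeTheory/DualLefschetzInLefschetzInvolutionAlgebra*.lean` (singular cohomology) and the Kähler-layer
files under `Geometry/Kaehler/` are announced BY NAME only (RULING 29: different carriers); nothing restated, nothing imported.

## References

* [Milne1999LefschetzClasses] J. S. Milne, *Lefschetz classes on abelian varieties*, Duke Math. J. 96 (1999) 639–675, §5 p. 664,
  Prop. 5.7, Thm. 5.9 (p. 665).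
* [Andre1996Motifs] Y. André, *Pour une théorie inconditionnelle des motifs*, Publ. Math. IHÉS 83 (1996), §1.2, Prop. 1.2 (pp. 11–12).
* [Kleiman1968AlgebraicCycles] S. L. Kleiman, *Algebraic cycles and the Weil conjectures* (1968), §1.4, 1.4.4–1.4.5 (via André, Milne).
-/

noncomputable section

universe u v

/-! ## §1 The exterior algebra of a symplectic space -/

namespace Literature.AlgebraicGeometry.Motives.ExteriorLefschetz

open Literature.Algebra.Lie ExteriorAlgebra Module Function Set
open Literature.Algebra.Lie.HasLefschetzProperty (primitiveSpace mem_primitiveSpace_iff)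

section Symplectic

variable {K : Type u} [Field K] [CharZero K] {W : Type v} [AddCommGroup W] [Module K W]
variable {ω : ExteriorAlgebra K W} {g : ℕ}

/-- **`h ∈ K[e_ω, ᶜΛ]`** (`h = [e_ω, ᶜΛ]`; André's "posons `h = Σ (d - j) πʲ` […] `[ᶜΛ, L] = h`").
[cite: Andre1996Motifs, §1.2 (p. 11)] [cite: Kleiman1968AlgebraicCycles, §1.4, 1.4.6] -/
theorem IsSymplectic.shiftedDegree_mem_adjoin_lefschetzDual (hω : IsSymplectic ω g) (hg : 0 < g) :
    shiftedDegree K (fun i : ℕ ↦ ⋀[K]^i W) g ∈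
      Algebra.adjoin K ({LinearMap.mul K (ExteriorAlgebra K W) ω, lefschetzDual ω g} : Set (Module.End K (ExteriorAlgebra K W))) := by
  haveI := hω.finiteDimensional_exteriorAlgebra
  rw [← hω.dual_eq_lefschetzDual hg]
  exact hω.hasLefschetzProperty_mul.h_mem_adjoin_pair_dual _

/-- **"… et contiennent les projecteurs de Künneth": the projector of `⋀ W = ⊕ⱼ ⋀ʲ W` onto `⋀ʲ W` lies in `K[e_ω, ᶜΛ]`** (it is the
degree projector onto `M_{j-g}` of `(⋀ W, h)`, a Lagrange polynomial in `h ∈ K[e_ω, ᶜΛ]`; row g30-#1).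
[cite: Andre1996Motifs, Prop. 1.2 (p. 11)] [cite: Kleiman1968AlgebraicCycles, §1.4, 1.4.5] -/
theorem IsSymplectic.proj_mem_adjoin_lefschetzDual (hω : IsSymplectic ω g) (hg : 0 < g) (j : ℕ) :
    GradedAlgebra.proj (fun i : ℕ ↦ ⋀[K]^i W) j ∈
      Algebra.adjoin K ({LinearMap.mul K (ExteriorAlgebra K W) ω, lefschetzDual ω g} : Set (Module.End K (ExteriorAlgebra K W))) := by
  haveI := hω.finiteDimensional_exteriorAlgebra
  obtain ⟨π, hπA, hπ⟩ := hω.hasLefschetzProperty_mul.exists_degreeProj_mem_adjoin_pair_dual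
    (isZGrading_shiftedDegree K (fun i : ℕ ↦ ⋀[K]^i W) g) ((j : ℤ) - g)
  rw [hω.dual_eq_lefschetzDual hg] at hπA
  -- the Künneth projector agrees with `π` on every `⋀ⁱ W`
  suffices h : GradedAlgebra.proj (fun i : ℕ ↦ ⋀[K]^i W) j = π by rw [h]; exact hπA
  refine LinearMap.ext fun x ↦ ?_
  induction x using DirectSum.Decomposition.inductionOn (fun i : ℕ ↦ ⋀[K]^i W) with
  | zero => rw [map_zero, map_zero]
  | @homogeneous i x =>
    rw [hπ ((i : ℤ) - g) x ((mem_degreeSpace_shiftedDegree_iff g).2 x.2), GradedAlgebra.proj_apply]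
    by_cases hij : i = j
    · subst hij
      rw [DirectSum.decompose_of_mem_same (fun i : ℕ ↦ ⋀[K]^i W) x.2, if_pos rfl]
    · rw [DirectSum.decompose_of_mem_ne (fun i : ℕ ↦ ⋀[K]^i W) x.2 hij, if_neg fun h ↦ hij (by exact_mod_cast sub_left_injective h)]
  | add x y hx hy => rw [map_add, map_add, hx, hy]

/-- **Kleiman 1968, 1.4.5 on the exterior algebra: `*_L ∈ K[e_ω, ᶜΛ]`** (the abstract `lefschetzInvolution_mem_adjoin_pair_dual` of row
g30-#1 read through `lefschetzStar_eq` and `dual_eq_lefschetzDual`). [cite: Andre1996Motifs, Prop. 1.2 (p. 11)]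
[cite: Kleiman1968AlgebraicCycles, §1.4, 1.4.5] -/
theorem IsSymplectic.lefschetzStar_mem_adjoin_lefschetzDual (hω : IsSymplectic ω g) (hg : 0 < g) :
    lefschetzStar ω g ∈
      Algebra.adjoin K ({LinearMap.mul K (ExteriorAlgebra K W) ω, lefschetzDual ω g} : Set (Module.End K (ExteriorAlgebra K W))) := by
  haveI := hω.finiteDimensional_exteriorAlgebra
  rw [← hω.dual_eq_lefschetzDual hg, hω.lefschetzStar_eq]
  exact hω.hasLefschetzProperty_mul.lefschetzInvolution_mem_adjoin_pair_dual _

/-- **"this algebra contains […] `∗`": `∗ ∈ K[e_ω, ᶜΛ]`.** [cite: Milne1999LefschetzClasses, §5 Thm. 5.9 (proof, p. 665)]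
[cite: Andre1996Motifs, Prop. 1.2 (p. 11)] -/
theorem IsSymplectic.hodgeStar_mem_adjoin_lefschetzDual (hω : IsSymplectic ω g) (hg : 0 < g) :
    hodgeStar ω g ∈
      Algebra.adjoin K ({LinearMap.mul K (ExteriorAlgebra K W) ω, lefschetzDual ω g} : Set (Module.End K (ExteriorAlgebra K W))) := by
  haveI := hω.finiteDimensional_exteriorAlgebra
  rw [← hω.dual_eq_lefschetzDual hg, hω.hodgeStar_eq]
  exact hω.hasLefschetzProperty_mul.hodgeInvolution_mem_adjoin_pair_dual _ g

/-- **Milne's `Λ = *_L e_ω *_L` ("inverse to `L`") lies in `K[e_ω, ᶜΛ]`.** [cite: Milne1999LefschetzClasses, §5 p. 664 and Thm. 5.9 (proof, p. 665)]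
[cite: Andre1996Motifs, Prop. 1.2 (p. 11)] -/
theorem IsSymplectic.conj_lefschetzStar_mem_adjoin_lefschetzDual (hω : IsSymplectic ω g) (hg : 0 < g) :
    lefschetzStar ω g * LinearMap.mul K (ExteriorAlgebra K W) ω * lefschetzStar ω g ∈
      Algebra.adjoin K ({LinearMap.mul K (ExteriorAlgebra K W) ω, lefschetzDual ω g} : Set (Module.End K (ExteriorAlgebra K W))) :=
  Subalgebra.mul_mem _ (Subalgebra.mul_mem _ (hω.lefschetzStar_mem_adjoin_lefschetzDual hg)
    (Algebra.subset_adjoin (Set.mem_insert _ _))) (hω.lefschetzStar_mem_adjoin_lefschetzDual hg)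

/-- **ANDRÉ PROP. 1.2 ON `⋀ W`: `K[e_ω, *_L] = K[e_ω, ᶜΛ]`.** [cite: Andre1996Motifs, Prop. 1.2 (p. 11)] [cite: Kleiman1968AlgebraicCycles, §1.4, 1.4.4–1.4.5] -/
theorem IsSymplectic.adjoin_lefschetzStar_eq_adjoin_lefschetzDual (hω : IsSymplectic ω g) (hg : 0 < g) :
    Algebra.adjoin K ({LinearMap.mul K (ExteriorAlgebra K W) ω, lefschetzStar ω g} : Set (Module.End K (ExteriorAlgebra K W))) =
      Algebra.adjoin K ({LinearMap.mul K (ExteriorAlgebra K W) ω, lefschetzDual ω g} : Set (Module.End K (ExteriorAlgebra K W))) := by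
  haveI := hω.finiteDimensional_exteriorAlgebra
  rw [← hω.dual_eq_lefschetzDual hg, hω.lefschetzStar_eq]
  exact hω.hasLefschetzProperty_mul.adjoin_pair_lefschetzInvolution_eq_adjoin_pair_dual _

/-- **`K[e_ω, ∗] = K[e_ω, ᶜΛ]`.** [cite: Andre1996Motifs, Prop. 1.2 (p. 11)] [cite: Milne1999LefschetzClasses, §5 Thm. 5.9 (proof, p. 665)] -/
theorem IsSymplectic.adjoin_hodgeStar_eq_adjoin_lefschetzDual (hω : IsSymplectic ω g) (hg : 0 < g) :
    Algebra.adjoin K ({LinearMap.mul K (ExteriorAlgebra K W) ω, hodgeStar ω g} : Set (Module.End K (ExteriorAlgebra K W))) =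
      Algebra.adjoin K ({LinearMap.mul K (ExteriorAlgebra K W) ω, lefschetzDual ω g} : Set (Module.End K (ExteriorAlgebra K W))) := by
  rw [← hω.adjoin_lefschetzStar_eq_adjoin_hodgeStar, hω.adjoin_lefschetzStar_eq_adjoin_lefschetzDual hg]

/-- **Milne's `ℚ[L, Λ]` is the same algebra: `K[e_ω, *_L e_ω *_L] = K[e_ω, ᶜΛ]`.** [cite: Milne1999LefschetzClasses, §5 Thm. 5.9 (proof, p. 665)]
[cite: Andre1996Motifs, Prop. 1.2 (p. 11)] [cite: Kleiman1968AlgebraicCycles, §1.4, 1.4.4–1.4.5] -/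
theorem IsSymplectic.adjoin_conj_lefschetzStar_eq_adjoin_lefschetzDual (hω : IsSymplectic ω g) (hg : 0 < g) :
    Algebra.adjoin K ({LinearMap.mul K (ExteriorAlgebra K W) ω,
        lefschetzStar ω g * LinearMap.mul K (ExteriorAlgebra K W) ω * lefschetzStar ω g} : Set (Module.End K (ExteriorAlgebra K W))) =
      Algebra.adjoin K ({LinearMap.mul K (ExteriorAlgebra K W) ω, lefschetzDual ω g} : Set (Module.End K (ExteriorAlgebra K W))) := by
  haveI := hω.finiteDimensional_exteriorAlgebra
  rw [← hω.dual_eq_lefschetzDual hg, hω.lefschetzStar_eq]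
  exact hω.hasLefschetzProperty_mul.adjoin_pair_conj_lefschetzInvolution_eq_adjoin_pair_dual _

/-- **MILNE, THM. 5.9, "Since this algebra [`ℚ[L, Λ]`] contains `ᶜΛ` […] (Kleiman 1968, 1.4.4)": `ᶜΛ ∈ K[e_ω, *_L e_ω *_L]`.**
[cite: Milne1999LefschetzClasses, §5 Thm. 5.9 (proof, p. 665)] [cite: Kleiman1968AlgebraicCycles, §1.4, 1.4.4] -/
theorem IsSymplectic.lefschetzDual_mem_adjoin_conj_lefschetzStar (hω : IsSymplectic ω g) (hg : 0 < g) :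
    lefschetzDual ω g ∈ Algebra.adjoin K ({LinearMap.mul K (ExteriorAlgebra K W) ω,
      lefschetzStar ω g * LinearMap.mul K (ExteriorAlgebra K W) ω * lefschetzStar ω g} : Set (Module.End K (ExteriorAlgebra K W))) := by
  rw [hω.adjoin_conj_lefschetzStar_eq_adjoin_lefschetzDual hg]
  exact Algebra.subset_adjoin (Set.mem_insert_of_mem _ rfl)

/-- **"… and `∗`": `∗ ∈ K[e_ω, *_L e_ω *_L]`.** [cite: Milne1999LefschetzClasses, §5 Thm. 5.9 (proof, p. 665)] [cite: Andre1996Motifs, Prop. 1.2 (p. 11)] -/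
theorem IsSymplectic.hodgeStar_mem_adjoin_conj_lefschetzStar (hω : IsSymplectic ω g) (hg : 0 < g) :
    hodgeStar ω g ∈ Algebra.adjoin K ({LinearMap.mul K (ExteriorAlgebra K W) ω,
      lefschetzStar ω g * LinearMap.mul K (ExteriorAlgebra K W) ω * lefschetzStar ω g} : Set (Module.End K (ExteriorAlgebra K W))) := by
  rw [hω.adjoin_conj_lefschetzStar_eq_adjoin_lefschetzDual hg]
  exact hω.hodgeStar_mem_adjoin_lefschetzDual hg

/-- The Künneth projectors lie in Milne's `ℚ[L, Λ]` as well. [cite: Andre1996Motifs, Prop. 1.2 (p. 11)] [cite: Milne1999LefschetzClasses, §5 Thm. 5.9 (proof, p. 665)] -/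
theorem IsSymplectic.proj_mem_adjoin_conj_lefschetzStar (hω : IsSymplectic ω g) (hg : 0 < g) (j : ℕ) :
    GradedAlgebra.proj (fun i : ℕ ↦ ⋀[K]^i W) j ∈ Algebra.adjoin K ({LinearMap.mul K (ExteriorAlgebra K W) ω,
      lefschetzStar ω g * LinearMap.mul K (ExteriorAlgebra K W) ω * lefschetzStar ω g} : Set (Module.End K (ExteriorAlgebra K W))) := by
  rw [hω.adjoin_conj_lefschetzStar_eq_adjoin_lefschetzDual hg]
  exact hω.proj_mem_adjoin_lefschetzDual hg j

/-- The Künneth projectors lie in `K[e_ω, *_L]`. [cite: Andre1996Motifs, Prop. 1.2 (p. 11)] -/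
theorem IsSymplectic.proj_mem_adjoin_lefschetzStar (hω : IsSymplectic ω g) (hg : 0 < g) (j : ℕ) :
    GradedAlgebra.proj (fun i : ℕ ↦ ⋀[K]^i W) j ∈
      Algebra.adjoin K ({LinearMap.mul K (ExteriorAlgebra K W) ω, lefschetzStar ω g} : Set (Module.End K (ExteriorAlgebra K W))) := by
  rw [hω.adjoin_lefschetzStar_eq_adjoin_lefschetzDual hg]
  exact hω.proj_mem_adjoin_lefschetzDual hg j

/-- **`Sp(ω)`-equivariance of the whole algebra `K[e_ω, ᶜΛ]`**: `⋀(f)` with `⋀(f) ω = ω` commutes with every element of it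
("commutes with the action of `L(A)`, which implies that the same is true of `Λ` […]"). [cite: Milne1999LefschetzClasses, §5 Thm. 5.9 (proof, p. 665)] -/
theorem IsSymplectic.commute_map_of_mem_adjoin_lefschetzDual (hω : IsSymplectic ω g) (hg : 0 < g) (f : W →ₗ[K] W)
    (hf : ExteriorAlgebra.map f ω = ω) {T : Module.End K (ExteriorAlgebra K W)}
    (hT : T ∈ Algebra.adjoin K ({LinearMap.mul K (ExteriorAlgebra K W) ω, lefschetzDual ω g} : Set (Module.End K (ExteriorAlgebra K W)))) :
    Commute (ExteriorAlgebra.map f).toLinearMap T := by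
  rw [← hω.adjoin_lefschetzStar_eq_adjoin_lefschetzDual hg] at hT
  exact hω.commute_map_of_mem_adjoin f hf hT

end Symplectic

end Literature.AlgebraicGeometry.Motives.ExteriorLefschetz

/-! ## §2 The carrier of a polarized `ℚ`-Hodge structure of odd weight -/

namespace Literature.AlgebraicGeometry.Motives.HodgeStructure

open ExteriorLefschetz ExteriorAlgebra
open scoped TensorProduct

variable {V : Type u} [AddCommGroup V] [Module ℚ V] [Module.Finite ℚ V] {n : ℤ} {H : HodgeStructure V n}
  (Q : Polarization H) (hn : Odd n) {g : ℕ} (hg : Module.finrank ℚ V = 2 * g)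

include hn hg in
/-- **MILNE 1999, THM. 5.9 ON THE CARRIER for `ℚ[L, ᶜΛ]` (= `ℚ[L, Λ]` = `ℚ[L, *_L]` = `ℚ[L, ∗]`): every `T ∈ ℚ[e_E, ᶜΛ_E]` maps the
`ℚ`-algebra `ℚ[B¹] ⊆ ⋀_ℚ V` generated by the degree-two Hodge classes into itself** (row g29-#6 proved it for `ℚ[e_E, *_L]`; the
two algebras coincide by §1). [cite: Milne1999LefschetzClasses, §5 Thm. 5.9 (pp. 664–665)] [cite: Andre1996Motifs, Prop. 1.2 (p. 11)] -/
theorem Polarization.apply_mem_adjoin_hodgeClasses_two_of_mem_adjoin_lefschetzDual (hg0 : 0 < g)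
    {T : Module.End ℚ (ExteriorAlgebra ℚ V)}
    (hT : T ∈ Algebra.adjoin ℚ ({LinearMap.mul ℚ (ExteriorAlgebra ℚ V) (Q.lefschetzClass : ExteriorAlgebra ℚ V),
      lefschetzDual (Q.lefschetzClass : ExteriorAlgebra ℚ V) g} : Set (Module.End ℚ (ExteriorAlgebra ℚ V))))
    {x : ExteriorAlgebra ℚ V}
    (hx : x ∈ Algebra.adjoin ℚ (((H.exteriorPower 2).hodgeClasses n).map (⋀[ℚ]^2 V).subtype : Set (ExteriorAlgebra ℚ V))) :
    T x ∈ Algebra.adjoin ℚ (((H.exteriorPower 2).hodgeClasses n).map (⋀[ℚ]^2 V).subtype : Set (ExteriorAlgebra ℚ V)) := by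
  rw [← (Q.isSymplectic_lefschetzClass hn hg).adjoin_lefschetzStar_eq_adjoin_lefschetzDual hg0] at hT
  exact Q.apply_mem_adjoin_hodgeClasses_two_of_mem_adjoin_lefschetzStar hn hg hT hx

include hn hg in
/-- **Prop. 5.7 for `T ∈ ℚ[e_E, ᶜΛ_E]`**: an element of `ℚ[L, ᶜΛ]` carrying `⋀^{2p}` into `⋀^{2q}` maps `Dᵖ` into `D^q`.
[cite: Milne1999LefschetzClasses, §5 Prop. 5.7 and Thm. 5.9 (pp. 664–665)] -/
theorem Polarization.apply_mem_map_divisorClasses_of_mem_adjoin_lefschetzDual (hg0 : 0 < g) {p q : ℕ}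
    {T : Module.End ℚ (ExteriorAlgebra ℚ V)}
    (hT : T ∈ Algebra.adjoin ℚ ({LinearMap.mul ℚ (ExteriorAlgebra ℚ V) (Q.lefschetzClass : ExteriorAlgebra ℚ V),
      lefschetzDual (Q.lefschetzClass : ExteriorAlgebra ℚ V) g} : Set (Module.End ℚ (ExteriorAlgebra ℚ V))))
    (hTdeg : ∀ y ∈ ⋀[ℚ]^(2 * p) V, T y ∈ ⋀[ℚ]^(2 * q) V)
    {x : ExteriorAlgebra ℚ V} (hx : x ∈ (H.divisorClasses p).map (⋀[ℚ]^(2 * p) V).subtype) :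
    T x ∈ (H.divisorClasses q).map (⋀[ℚ]^(2 * q) V).subtype := by
  rw [← (Q.isSymplectic_lefschetzClass hn hg).adjoin_lefschetzStar_eq_adjoin_lefschetzDual hg0] at hT
  exact Q.apply_mem_map_divisorClasses_of_mem_adjoin_lefschetzStar hn hg hT hTdeg hx

include Q hn hg in
/-- **The Künneth projectors are Lefschetz on the carrier**: the projector of `⋀_ℚ V` onto `⋀ʲ_ℚ V` maps `ℚ[B¹]` into itself
(it lies in `ℚ[e_E, ᶜΛ_E]`). [cite: Andre1996Motifs, Prop. 1.2 (p. 11)] [cite: Milne1999LefschetzClasses, §5 Thm. 5.9 (pp. 664–665)] -/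
theorem Polarization.proj_apply_mem_adjoin_hodgeClasses_two (hg0 : 0 < g) (j : ℕ) {x : ExteriorAlgebra ℚ V}
    (hx : x ∈ Algebra.adjoin ℚ (((H.exteriorPower 2).hodgeClasses n).map (⋀[ℚ]^2 V).subtype : Set (ExteriorAlgebra ℚ V))) :
    GradedAlgebra.proj (fun i : ℕ ↦ ⋀[ℚ]^i V) j x ∈
      Algebra.adjoin ℚ (((H.exteriorPower 2).hodgeClasses n).map (⋀[ℚ]^2 V).subtype : Set (ExteriorAlgebra ℚ V)) :=
  Q.apply_mem_adjoin_hodgeClasses_two_of_mem_adjoin_lefschetzDual hn hg hg0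
    ((Q.isSymplectic_lefschetzClass hn hg).proj_mem_adjoin_lefschetzDual hg0 j) hx

end Literature.AlgebraicGeometry.Motives.HodgeStructure

end
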